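import Literature.NumberTheory.LFunctions.ClassGroupLogFreeMiddleRangeAllDegrees
import Literature.NumberTheory.LFunctions.ClassGroupLogFreeTheorem14
import Literature.NumberTheory.LFunctions.LogFreeLargeRangeAllDegrees
import HarnessLib

/-!
# Bombieri's Théorème 14 for the class group characters, III: assembly — every degree

Topic `Literature/NumberTheory/LFunctions`, namespace `Literature.NumberTheory.LFunctions.NumberField`.
Everything here is PROVED (theorems only; no definitions, no named facts).

The tree's `logFreeDensity_classGroup (n) (hn : n ≤ 4)` (`ClassGroupLogFreeTheorem14.lean`) is the
log-free zero-density estimate for the non-trivial class group `L`-functions of a number field of degree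
`n ≤ 4`.  The degree restriction was purely numerical (Lemme B slack, kernel width, size constants); with the
all-degree middle range (`middleRange_CG_of_le`) and the trivial range with the degree-dependent height bound
(`largeRange_CG_of_le` of `LogFreeLargeRangeAllDegrees.lean`, cell B2b-1 PART B) the assembly of the tree goes
through verbatim:

* `logFreeDensity_classGroup_all (n)` — **the log-free zero-density estimate in every degree**, EXACTLY the
  shape of `logFreeDensity_classGroup n hn` without `hn`:
  `Σ_{χ ≠ 1} Σ_{ρ ∈ Z(χ), β ≥ α} m(ρ) ≤ C_D P^{c_D(1−α)}` (`0 ≤ α ≤ 1`).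

This is the `χ ≠ 1` half of Weiss 1983 Thm. 4.3 / Thorner–Zaman 2019 Thm. 3.2 (for `H = P_K`, without the
Deuring–Heilbronn factor `B₁`), uniformly over the number fields of a fixed degree.

## References

* [Bombieri1987GrandCrible] E. Bombieri, Astérisque 18 (1987), §6 Théorème 14.
* [ThornerZaman2017] J. Thorner, A. Zaman, Algebra Number Theory 11 (2017), §5–6.
* [ThornerZaman2019] J. Thorner, A. Zaman, Algebra Number Theory 13 (2019), Theorems 3.1–3.2.
* [Weiss1983] A. Weiss, J. reine angew. Math. 338 (1983) 56–94, Thm. 4.3.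
-/

noncomputable section

open Complex Finset Filter Real MeasureTheory
open scoped LSeries.notation ArithmeticFunction.vonMangoldt Topology Nat

namespace Literature.NumberTheory.LFunctions.NumberField

open Literature.NumberTheory.LFunctions.LogFreeLocal Literature.NumberTheory.LFunctions.LogFreeDensity
  Literature.NumberTheory.LFunctions.AbelianDensity
open scoped nonZeroDivisors _root_.NumberField

/-! ### The trivial range: all the zeros with `1/4 ≤ β < 1`, `|γ| ≤ P` -/

open scoped Classical in
/-- **The log-free zero-density estimate for the class group `L`-functions of a number field, every
degree** (Bombieri's Théorème 14 for the family `{L₀(s, χ)}_{χ ∈ Ĉl_K, χ ≠ 1}`; Weiss 1983 Thm. 4.3,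
Thorner–Zaman 2017 §5–6, 2019 Theorem 3.2 for `H = P_K` — without the Deuring–Heilbronn factor): for every
degree `n` there are `c_D, C_D > 0` such that for every number field `K` of degree `n` whose `L₀(s, χ)`,
`χ ≠ 1`, do not vanish on `Re s ≥ 1`, every `P ≥ 2` with `|d_K| ≤ P`, `h_K ≤ P`, `κ_K ≥ 1/P`, all finite sets
`Z(χ)` of zeros of `L₀(s, χ)` with `1/4 ≤ β < 1`, `|γ| ≤ P`, and every `0 ≤ α ≤ 1`,
`Σ_{χ ≠ 1} Σ_{ρ ∈ Z(χ), β ≥ α} m(ρ) ≤ C_D P^{c_D(1−α)}` — EXACTLY the shape of the tree's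
`logFreeDensity_classGroup n (n ≤ 4)`, with the degree hypothesis removed.
[cite: Bombieri1987GrandCrible, §6 Théorème 14] -/
theorem logFreeDensity_classGroup_all (n : ℕ) :
    ∃ c_D C_D : ℝ, 0 < c_D ∧ 0 < C_D ∧
      ∀ (K : Type) [Field K] [NumberField K], Module.finrank ℚ K = n →
        (∀ χ : ClassGroup (𝓞 K) →* ℂˣ, χ ≠ 1 → ∀ ρ : ℂ, classGroupLFunction₀ K χ ρ = 0 → ρ.re < 1) →
        ∀ P : ℝ, 2 ≤ P → ((NumberField.discr K).natAbs : ℝ) ≤ P →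
          (Fintype.card (ClassGroup (𝓞 K)) : ℝ) ≤ P → P⁻¹ ≤ NumberField.dedekindZeta_residue K →
        ∀ Z : (ClassGroup (𝓞 K) →* ℂˣ) → Finset ℂ,
          (∀ χ : ClassGroup (𝓞 K) →* ℂˣ, χ ≠ 1 → ∀ ρ ∈ Z χ,
              classGroupLFunction₀ K χ ρ = 0 ∧ 1 / 4 ≤ ρ.re ∧ ρ.re < 1 ∧ |ρ.im| ≤ P) →
          ∀ α : ℝ, 0 ≤ α → α ≤ 1 →
            ∑ ψ : AddChar (Additive (ClassGroup (𝓞 K))) ℂ with ψ ≠ 0,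
              ∑ ρ ∈ Z (toMulHom ψ).toHomUnits with α ≤ ρ.re,
                (zeroOrder (classGroupLFunction₀ K (toMulHom ψ).toHomUnits) ρ : ℝ) ≤ C_D * P ^ (c_D * (1 - α)) := by
  obtain ⟨c₁, hc₁, hsmall⟩ := smallRange_CG n
  obtain ⟨δ₀, A, C, hδ₀, hA, hC, hmid⟩ := middleRange_CG_of_le n hc₁
  obtain ⟨C₃, hC₃, hlarge⟩ := largeRange_CG_of_le n
  refine ⟨max A (3 / δ₀), max (max 1 C) C₃, by positivity, by positivity,
    fun K _ _ hK hline P hP hd hh hκ Z hZ α hα0 hα1 => ?_⟩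
  have hnK : Module.finrank ℚ K ≤ n := hK.le
  have hP1 : 1 ≤ P := by linarith
  have hexp0 : 0 ≤ max A (3 / δ₀) * (1 - α) := mul_nonneg (by positivity) (by linarith)
  have hPpow1 : 1 ≤ P ^ (max A (3 / δ₀) * (1 - α)) := Real.one_le_rpow hP1 hexp0
  have hCD1 : 1 ≤ max (max 1 C) C₃ := (le_max_left _ _).trans' (le_max_left _ _)
  rcases lt_or_ge (1 - α) (c₁ / Real.log P) with h1 | h1
  · -- near `α = 1`
    refine (hsmall K hK P hP hd Z (fun χ hχ ρ hρ ↦ ⟨(hZ χ hχ ρ hρ).1, (hZ χ hχ ρ hρ).2.2.2⟩) α h1).trans ?_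
    calc (1 : ℝ) ≤ max (max 1 C) C₃ * 1 := by linarith
      _ ≤ _ := mul_le_mul_of_nonneg_left hPpow1 (by positivity)
  rcases le_or_gt (1 - α) δ₀ with h2 | h2
  · -- the middle range
    refine (hmid K hnK hline P hP hd hh hκ Z (fun χ hχ ρ hρ ↦ ?_) α h1 h2).trans ?_
    · obtain ⟨h0, hβ, hβ1, him⟩ := hZ χ hχ ρ hρ
      exact ⟨h0, by linarith, hβ1, him⟩
    refine mul_le_mul ((le_max_right _ _).trans (le_max_left _ _)) ?_ (by positivity) (by positivity)
    exact Real.rpow_le_rpow_of_exponent_le hP1 (mul_le_mul_of_nonneg_right (le_max_left _ _) (by linarith))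
  · -- the trivial range
    have hsub : ∑ ψ : AddChar (Additive (ClassGroup (𝓞 K))) ℂ with ψ ≠ 0,
        ∑ ρ ∈ Z (toMulHom ψ).toHomUnits with α ≤ ρ.re,
          (zeroOrder (classGroupLFunction₀ K (toMulHom ψ).toHomUnits) ρ : ℝ) ≤
        ∑ ψ : AddChar (Additive (ClassGroup (𝓞 K))) ℂ with ψ ≠ 0,
          ∑ ρ ∈ Z (toMulHom ψ).toHomUnits, (zeroOrder (classGroupLFunction₀ K (toMulHom ψ).toHomUnits) ρ : ℝ) :=
      sum_le_sum fun ψ _ => sum_le_sum_of_subset_of_nonneg (filter_subset _ _) fun ρ _ _ => Nat.cast_nonneg _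
    refine hsub.trans ((hlarge K hnK P hP hd hh Z (fun χ hχ ρ hρ ↦ ?_)).trans ?_)
    · obtain ⟨h0, hβ, hβ1, him⟩ := hZ χ hχ ρ hρ
      exact ⟨h0, hβ, hβ1.le, him⟩
    refine mul_le_mul (le_max_right _ _) ?_ (by positivity) (by positivity)
    rw [← Real.rpow_natCast]
    refine Real.rpow_le_rpow_of_exponent_le hP1 ?_
    push_cast
    have : (3 : ℝ) ≤ 3 / δ₀ * (1 - α) := by
      rw [div_mul_eq_mul_div, le_div_iff₀ hδ₀]; nlinarith
    exact this.trans (mul_le_mul_of_nonneg_right (le_max_right _ _) (by linarith))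

end Literature.NumberTheory.LFunctions.NumberField

end
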